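import Literature.MathematicalPhysics.QuantumFieldTheory.Balaban1983to89.B8Ineq159TopCubeTowerReads
import Literature.MathematicalPhysics.QuantumFieldTheory.Balaban1983to89.B9Eq316AveragingTransposeZdLinear
import Literature.MathematicalPhysics.QuantumFieldTheory.Balaban1983to89.B9SupplySockB9P3ZdLettersOmega

/-!
# `Balaban1983to89.B8Ineq159TopCubeTowerSourceReads` — [Balaban1985RegularSpaces] (1.146) p. 101, (1.59) p. 86, (1.31) p. 82, (1.131) p. 99 ∕
# [Balaban1985Averaging] (127) p. 37: the reads for the SOURCED socket of Proposition 3's frame at print's top-cube tower — a line-integral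
# DIVERGENCE POTENTIAL `D^{η*}_{U₀}A″ = f`, the transfer of the sourced Landau condition (1.146) to the cube member's (1.38) for the field `A′ − A″`,
# and the class averages `Q_j(U₀)` of a bounded field on print's class (crossing bonds read the collar: the SHIFTED regime)

statement-level skeleton of published theorems with citation tags; proofs where landed; nothing here is a claim about the
Yang–Mills mass gap

`[Balaban1985RegularSpaces]` ("B8", CMP **99** (1985) 75–102) (1.1) p. 76, (1.7) p. 77, (1.31) p. 82, (1.38) p. 82, (1.59) p. 86, (1.131) p. 99, (1.146) p. 101
(«R(U₀)D^{η*}_{U₀}A = f»); [4] = `[Balaban1985BackgroundPropagators]` (3.23)–(3.25) p. 394; [B7] = `[Balaban1985Averaging]` (127) p. 37, Prop. 5 p. 42 (the linear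
averaging `Q_j(U₀)` and its bound in the regime (1.7)); [B6] = `[Balaban1984PropagatorsII]` (2.3) p. 224.

CITATION HEADER (lean-in-tree rule).  Cell `pub-ymgap` (YM Track A, HUMAN RULING D-0062 ∕ D-0149), node N05 = [B8], width seat `pub-ymgap-dag-n05-w3` (g4), CLAIM-2 file (D).
WHY.  Files (A)–(C) of this seat (`B8Ineq159TopCubeTowerReads`, `B8SockB9P3H2AtTopCubeTower(Member)`) inhabit the SOURCELESS socket `SB9P` of the P₂D slot at the
top-cube tower, per member.  The slot's next binder `SB9srcHP` (dag-n05-d p619291) is the SOURCED socket: the Landau condition is (1.146) `R(U₀)D^{η*}_{U₀}A′ = f` with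
a source `f ∈ R(U₀)` of size `|f|₍₋₂₎, |∇f|₍₋₃₎ < γ₈(α₀+α₁)`, and the five lines carry the slack `γ″B₀(α₀+α₁)`.  Per member the source is absorbed by an explicit bond
field `A″` with `D^{η*}_{U₀}A″ = f` near the tower (a path-ordered sum along one axis), after which `A′ − A″` obeys the sourceless condition; THIS FILE supplies that
potential, the transfer, and the bound on the class averages of `A″` (a bounded field) that the assembly (file (E)) needs.

THE MATHEMATICS (kernel-checked).  §1 ★★ `exists_divPotential`: for `η > 0`, a `U1`-valued background, a direction `i₀`, a start `lo₀ ∈ ℤ` and a site function `f` with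
`‖f‖ ≤ b`: a bond field `A″` (only the `i₀`-component, zero below `lo₀`) with `D^{η*}_{U₀}A″(x) = f(x)` whenever `x_{i₀} ≥ lo₀` and `‖A″(x, κ)‖ ≤ (x_{i₀} − lo₀ + 1)⁺·η·b`
(recursion `A″(x) = R(U₀(x−e,i₀))⁻¹A″(x−e) − ηf(x)`, unitary transports).  §2 `covDivB_sub_fld` and ★★ `isLandau138_cube_of_univ_source`: if `Δ^η_{U₀}(D^{η*}_{U₀}A − f) =
Q′(U₀)ᵀμ` on `T` (the multiplier half of (1.146) at `Ω₀ = T`), `D^{η*}_{U₀}A″ = f` on `□₀`, and `A′ = A − A″` on the bonds touching `□₀`, then `A′` satisfies (1.38) at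
the cube member `{□_j}` (Dirichlet `□₀`, `cubeLamS … k`).  §3 `reg17_shift` (the regime (1.7) read one level down costs a factor `L²`), ★ `norm_linCovIter_cubeLamBP_le`
(the class average `LʲηQ_j(U₀)B(c)` on print's class at level `1 ≤ j ≤ k` of a field bounded by `β` on the bond's box is `≤ 2d(1 + θ(αL²))Lʲ·β` for `U₀ ∈ 𝔄_k(α)`,
`αL² ≤ α_Q` — [B7] Prop. 5 at the SHIFTED family, since a crossing bond's box lies in `□_{j−1}`), `linCovIter_sub_cubeLamBP` (additivity there).

HONEST SCOPE.  Bookkeeping and one elementary construction; no estimate of [B8] ∕ [4] is proved; count-neutral; N05 NOT discharged; one finite `𝕋⁴` programme at fixed `ε`,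
Bałaban as printed; the YM mass gap (Clay) is NOT proved by any of this — R4 closes the conditional finite-`𝕋⁴` rung `BalabanLadder.UV` only; nothing continuum ∕ ℝ⁴ ∕ OS.
No `sorry`, no `def`, no `instance`, no `notation`.  Unit `pub-ymgap-dag-n05-w3` (g4), 2026-08-28.
-/

noncomputable section

namespace Literature.MathematicalPhysics.QuantumFieldTheory.Balaban1983to89.B8Ineq159TopCubeTowerSourceReads

open B7Prop1Explicit B7Prop2Explicit B7Prop1Local B7Eq78Linearization
open B7Prop4GeneralLevels (linCovIter)
open B7Prop5Flat (BondIn)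
open B7Prop5GeneralLevels (thetaGen)
open B8Ineq132 (covDerivFwd covDeriv BondTouches PlaqTouches InAk norm_conjR_le)
open B8Eq138LandauZd (IsLandau138 QT QprimeT covDivB covLap)
open B8Eq131CubesAdmissible (cubeFam cubeFam_true_zero cubeFam_false_zero cubeFam_of_pos)
open B8Eq131Cubes (cube cube_anti)
open B8CubeMemberZd (cubeLamS cubeLamS_top mem_cubeLam_zero_iff)
open B8Ineq159FlatCubeMemberPrinted (cubeLamBP cubeLamBP_box_subset_pred)
open B9Eq316AveragingTransposeZd (Reg17 alphaQ reg17_of_inAk norm_linCovIter_le_of_reg17)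
open B9Eq316AveragingTransposeZdLinear (linCovIter_add_of_reg17)
open B9SupplySockB9P3ZdLettersOmega (covDivB_add)
open B8Ineq159TopCubeTowerReads (covDivB_congr_fld covLap_congr_fld add_e_mem_cube_zero)

-- `Site` alone would resolve to the torus sites of `Setup.lean`; re-export the `ℤ^d` sites of `B7Prop1Explicit`.
export B7Prop1Explicit (Site)

variable {d : ℕ} {𝔹 : Type*} [CStarAlgebra 𝔹] [Nontrivial 𝔹]

/-! ## §1 The line-integral divergence potential along one axis -/

section Potential

variable {η : ℝ} {U₀ : Site d → Fin d → 𝔹ˣ}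

/-- ★★ **A DIVERGENCE POTENTIAL FOR A BOUNDED SOURCE**: for `η > 0`, a `U1`-valued background, a direction `i₀`, a start coordinate `lo₀` and a site function `f`
with `‖f‖ ≤ b`, there is a bond field `A″` carried by the `i₀`-bonds only, vanishing below `lo₀`, with `D^{η*}_{U₀}A″(x) = f(x)` for `x_{i₀} ≥ lo₀` and
`‖A″(x, κ)‖ ≤ (x_{i₀} − lo₀ + 1)⁺·η·b` — the path-ordered sum `A″(x) = R(U₀(x−e_{i₀}, i₀))⁻¹A″(x−e_{i₀}) − ηf(x)` started at `x_{i₀} = lo₀`; the transports are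
isometries. (Elementary; used to cancel the source of (1.146) near a cube.) [cite: Balaban1985RegularSpaces, (1.1) p.76, (1.146) p.101] -/
theorem exists_divPotential (hη : 0 < η) (hU : ∀ x κ, U₀ x κ ∈ U1 𝔹) (i₀ : Fin d) (lo₀ : ℤ) (f : Site d → 𝔹) {b : ℝ} (hb : 0 ≤ b)
    (hf : ∀ x, ‖f x‖ ≤ b) :
    ∃ A'' : Site d → Fin d → 𝔹,
      (∀ (x : Site d) (κ : Fin d), κ ≠ i₀ → A'' x κ = 0) ∧
      (∀ x : Site d, x i₀ < lo₀ → A'' x i₀ = 0) ∧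
      (∀ x : Site d, lo₀ ≤ x i₀ → covDivB η U₀ A'' x = f x) ∧
      (∀ (x : Site d) (κ : Fin d), ‖A'' x κ‖ ≤ ((x i₀ - lo₀ + 1).toNat : ℝ) * (η * b)) := by
  classical
  -- the recursion in the number of steps from the start hyperplane
  let H : ℕ → Site d → 𝔹 := fun n =>
    Nat.rec (motive := fun _ => Site d → 𝔹) (fun _ => 0) (fun _ g x => conjR (U₀ (x - e i₀) i₀)⁻¹ (g (x - e i₀)) - η • f x) n
  have H0 : ∀ x, H 0 x = 0 := fun _ => rfl
  have Hs : ∀ n x, H (n + 1) x = conjR (U₀ (x - e i₀) i₀)⁻¹ (H n (x - e i₀)) - η • f x := fun _ _ => rfl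
  have Hb : ∀ n x, ‖H n x‖ ≤ (n : ℝ) * (η * b) := by
    intro n
    induction n with
    | zero => intro x; simp [H0]
    | succ n ih =>
      intro x
      rw [Hs, Nat.cast_succ, add_mul, one_mul]
      refine (norm_sub_le _ _).trans (add_le_add ((norm_conjR_le ((U1 𝔹).inv_mem (hU _ _)) _).trans (ih _)) ?_)
      rw [norm_smul, Real.norm_of_nonneg hη.le]
      exact mul_le_mul_of_nonneg_left (hf x) hη.le
  -- the step count of a site
  let N : Site d → ℕ := fun x => (x i₀ - lo₀ + 1).toNat
  have hcoord : ∀ x : Site d, (x - e i₀) i₀ = x i₀ - 1 := fun x => by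
    simp [e_apply]
  have hNpred : ∀ x : Site d, lo₀ ≤ x i₀ → N x = N (x - e i₀) + 1 := by
    intro x hx
    show (x i₀ - lo₀ + 1).toNat = ((x - e i₀) i₀ - lo₀ + 1).toNat + 1
    rw [hcoord]
    omega
  let A'' : Site d → Fin d → 𝔹 := fun x κ => if κ = i₀ then H (N x) x else 0
  have hAi : ∀ x, A'' x i₀ = H (N x) x := fun x => if_pos rfl
  have hAo : ∀ (x : Site d) (κ : Fin d), κ ≠ i₀ → A'' x κ = 0 := fun x κ hκ => if_neg hκ
  refine ⟨A'', hAo, fun x hx => ?_, fun x hx => ?_, fun x κ => ?_⟩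
  · -- below the start hyperplane the step count is `0`
    have hN0 : N x = 0 := by show (x i₀ - lo₀ + 1).toNat = 0; omega
    rw [hAi, hN0, H0]
  · -- the divergence identity at `x_{i₀} ≥ lo₀`
    unfold covDivB
    rw [Finset.sum_eq_single i₀ (fun ν _ hν => ?_) (fun h => absurd (Finset.mem_univ i₀) h)]
    · have hη0 : η ≠ 0 := hη.ne'
      simp only [covDeriv, hAi]
      rw [hNpred x hx, Hs, show conjR (U₀ (x - e i₀) i₀)⁻¹ (H (N (x - e i₀)) (x - e i₀)) -
          (conjR (U₀ (x - e i₀) i₀)⁻¹ (H (N (x - e i₀)) (x - e i₀)) - η • f x) = η • f x by abel,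
        smul_smul, inv_mul_cancel₀ hη0, one_smul]
    · have h0 : (fun z => A'' z ν) = fun _ => (0 : 𝔹) := funext fun z => hAo z ν hν
      rw [h0]
      exact B8Eq138LandauZd.covDeriv_zero_fun η U₀ ν x
  · -- the bound
    by_cases hκ : κ = i₀
    · rw [hκ, hAi]; exact Hb _ _
    · rw [hAo x κ hκ, norm_zero]; positivity

end Potential

/-! ## §2 The sourced Landau condition at the top-cube tower ⟹ (1.38) at the cube member for `A′ = A − A″` -/

section Landau

variable {η : ℝ} {U₀ : Site d → Fin d → 𝔹ˣ}

omit [Nontrivial 𝔹] in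
/-- `D^{η*}_{U₀}(A − B) = D^{η*}_{U₀}A − D^{η*}_{U₀}B` (additivity of (1.1)₂, `B9SupplySockB9P3ZdLettersOmega.covDivB_add`). [cite: Balaban1985RegularSpaces, (1.1) p.76] -/
theorem covDivB_sub_fld (A B : Site d → Fin d → 𝔹) (x : Site d) : covDivB η U₀ (A - B) x = covDivB η U₀ A x - covDivB η U₀ B x := by
  have h := covDivB_add η U₀ (A - B) B x
  rw [sub_add_cancel] at h
  rw [h, add_sub_cancel_right]

omit [Nontrivial 𝔹] in
/-- ★★ **THE SOURCED LANDAU CONDITION (1.146) OF THE TOP-CUBE TOWER IMPLIES THE CUBE MEMBER'S (1.38) FOR THE FIELD MINUS A DIVERGENCE POTENTIAL OF THE SOURCE.**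
If `Δ^η_{U₀}(D^{η*}_{U₀}A − f) = Q′(U₀)ᵀμ` on `T` (the multiplier half of (1.146) at `Ω₀ = T`, `Λ′₀ = T ∖ □₁`, `Λ′_j = cubeLamS … k j` above), `D^{η*}_{U₀}A″ = f` on `□₀`,
and `A′ = A − A″` on the bonds touching `□₀`, then `A′` satisfies (1.38) in multiplier form at the member `{□_j}_{j=0}^{k}` (Dirichlet `□₀`, `cubeLamS … k`): level-`0`
multiplier free on `□₀ ∖ □₁`, `𝟙_{□₀}` invisible inside `□₁` (collar `ρ ≥ 1`), and there `D^{η*}A′ = D^{η*}A − f` so the source is gone.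
[cite: Balaban1985RegularSpaces, (1.146) p.101, (1.38) p.82, (1.131) p.99, p.98; Balaban1985BackgroundPropagators, (3.23)–(3.25) p.394] -/
theorem isLandau138_cube_of_univ_source {L : ℕ} (hL : 1 ≤ L) (a : Site d) (M : ℕ) {ρ k : ℕ} (hρ : 1 ≤ ρ) (hk : 1 ≤ k)
    {Λ : ℕ → Set (Site d)} (hΛ0 : Λ 0 = (cube L a M ρ k 1)ᶜ) (hΛ : ∀ j, 1 ≤ j → j ≤ k → Λ j = cubeLamS L a M ρ k k j)
    {A A' A'' : Site d → Fin d → 𝔹} {f : Site d → 𝔹}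
    (hagree : ∀ (y : Site d) (τ : Fin d), BondTouches (cube L a M ρ k 0) y τ → A' y τ = A y τ - A'' y τ)
    (hdiv : ∀ x, x ∈ cube L a M ρ k 0 → covDivB η U₀ A'' x = f x)
    (hLan : ∃ μ : ℕ → Site d → 𝔹, ∀ x, covLap η U₀ (fun z => covDivB η U₀ A z - f z) x = QT L k Λ U₀ μ x) :
    IsLandau138 L k η (cubeFam false L a M ρ k 0) (cubeLamS L a M ρ k k) U₀ A' := by
  classical
  obtain ⟨μ, hμ⟩ := hLan
  set tail : Site d → 𝔹 := fun x => ∑ j ∈ Finset.range k, QprimeT L U₀ (j + 1) ((cubeLamS L a M ρ k k (j + 1)).indicator (μ (j + 1))) x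
    with htail
  set g' : Site d → 𝔹 := (cube L a M ρ k 0).indicator (covDivB η U₀ A') with hg'
  refine ⟨fun j x => if j = 0 then covLap η U₀ g' x - tail x else μ j x, fun x hx => ?_⟩
  rw [cubeFam_false_zero] at hx
  have hRHS : QT L k (cubeLamS L a M ρ k k) U₀ (fun j x => if j = 0 then covLap η U₀ g' x - tail x else μ j x) x =
      (cubeLamS L a M ρ k k 0).indicator (fun x => covLap η U₀ g' x - tail x) x + tail x := by
    unfold QT
    rw [Finset.sum_range_succ']
    have h1 : ∀ j ∈ Finset.range k, QprimeT L U₀ (j + 1)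
        ((cubeLamS L a M ρ k k (j + 1)).indicator ((fun (j : ℕ) (x : Site d) => if j = 0 then covLap η U₀ g' x - tail x else μ j x) (j + 1))) x =
        QprimeT L U₀ (j + 1) ((cubeLamS L a M ρ k k (j + 1)).indicator (μ (j + 1))) x := by
      intro j _
      have : (fun (x : Site d) => if j + 1 = 0 then covLap η U₀ g' x - tail x else μ (j + 1) x) = μ (j + 1) := by
        funext y; simp
      simp only [this]
    rw [Finset.sum_congr rfl h1, add_comm]
    rfl
  rw [cubeFam_false_zero, hRHS]
  by_cases h1 : x ∈ cube L a M ρ k 1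
  · have hx0 : x ∉ cubeLamS L a M ρ k k 0 := by
      rw [cubeLamS_top L a M ρ (Nat.zero_le k), mem_cubeLam_zero_iff hL a M ρ hk]; exact fun h => h.2 h1
    rw [Set.indicator_of_notMem hx0, zero_add]
    have hP' : covLap η U₀ (fun z => covDivB η U₀ A z - f z) x = tail x := by
      rw [hμ x]
      unfold QT
      rw [Finset.sum_range_succ']
      have h0 : (Λ 0).indicator (μ 0) x = 0 := Set.indicator_of_notMem (by rw [hΛ0]; exact fun h => h h1) _
      have e0 : QprimeT L U₀ 0 ((Λ 0).indicator (μ 0)) x = (Λ 0).indicator (μ 0) x := rfl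
      rw [e0, h0, add_zero]
      refine Finset.sum_congr rfl fun j hj => ?_
      rw [hΛ (j + 1) (by omega) (Nat.succ_le_of_lt (Finset.mem_range.mp hj))]
    rw [← hP']
    have hx00 : x ∈ cube L a M ρ k 0 := cube_anti (Nat.zero_le 1) hk h1
    -- on `□₀`: `𝟙_{□₀}D^{η*}A′ = D^{η*}A − D^{η*}A″ = D^{η*}A − f`
    have hdiv' : ∀ z, z ∈ cube L a M ρ k 0 → g' z = covDivB η U₀ A z - f z := by
      intro z hz
      rw [hg', Set.indicator_of_mem hz, ← hdiv z hz, ← covDivB_sub_fld]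
      exact covDivB_congr_fld z (fun ν => hagree _ _ (Or.inr (by rw [sub_add_cancel]; exact hz))) fun ν => hagree _ _ (Or.inl hz)
    exact covLap_congr_fld x (hdiv' x hx00) (fun ν => hdiv' _ (add_e_mem_cube_zero hρ hk h1 ν).1)
      fun ν => hdiv' _ (add_e_mem_cube_zero hρ hk h1 ν).2
  · have hx0 : x ∈ cubeLamS L a M ρ k k 0 := by
      rw [cubeLamS_top L a M ρ (Nat.zero_le k), mem_cubeLam_zero_iff hL a M ρ hk]; exact ⟨hx, h1⟩
    rw [Set.indicator_of_mem hx0, sub_add_cancel]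

end Landau

/-! ## §3 The class averages of a bounded field over print's class: the shifted regime -/

section Averages

omit [Nontrivial 𝔹] in
/-- **The regime (1.7) read one level down costs a factor `L²`**: `Reg17 L m Ω α U₀ → Reg17 L m (j ↦ Ω_{j−1}) (αL²) U₀` (`α L^{−2(j−1)} = αL²·L^{−2j}`; at `j = 0`
`Ω_{0−1} = Ω₀` and `α ≤ αL²`). [cite: Balaban1985RegularSpaces, (1.7) p.77] -/
theorem reg17_shift {L m : ℕ} (hL : 1 ≤ L) {Ω : ℕ → Set (Site d)} {α : ℝ} (hα : 0 ≤ α) {U₀ : Site d → Fin d → 𝔹ˣ}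
    (h : Reg17 L m Ω α U₀) : Reg17 L m (fun j => Ω (j - 1)) (α * (L : ℝ) ^ 2) U₀ := by
  have hL0 : (0 : ℝ) < L := by exact_mod_cast (show 0 < L by omega)
  have hL1 : (1 : ℝ) ≤ L := by exact_mod_cast hL
  intro j hj x μ ν hμν hp
  rcases Nat.eq_zero_or_pos j with rfl | hj1
  · have h0 := h 0 (Nat.zero_le m) x μ ν hμν (by simpa using hp)
    refine h0.trans_le ?_
    rw [pow_zero, inv_one, one_pow, mul_one, mul_one]
    have hL2 : (1 : ℝ) ≤ (L : ℝ) ^ 2 := one_le_pow₀ hL1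
    calc α = α * 1 := (mul_one α).symm
      _ ≤ α * (L : ℝ) ^ 2 := mul_le_mul_of_nonneg_left hL2 hα
  · have hp' : PlaqTouches (Ω (j - 1)) x μ ν := by simpa using hp
    have h1 := h (j - 1) (by omega) x μ ν hμν hp'
    refine h1.trans_le (le_of_eq ?_)
    obtain ⟨j', rfl⟩ : ∃ j', j = j' + 1 := ⟨j - 1, by omega⟩
    rw [Nat.add_sub_cancel]
    field_simp
    ring

variable {L : ℕ} {a : Site d} {M ρ k : ℕ} {η α : ℝ} {U₀ : Site d → Fin d → 𝔹ˣ}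

/-- The box of a class bond at level `j ≥ 1` lies in `Ω_{j−1}` of the top-cube tower (`□_{j−1}` for `j ≥ 2`, `T` for `j = 1`). [cite: Balaban1985RegularSpaces, (1.31) p.82, (1.131) p.99; Balaban1984PropagatorsII, (2.3) p.224] -/
theorem box_subset_shift_of_cubeLamBP (hL : 1 ≤ L) (hρ : L ≤ ρ) {j : ℕ} (hj1 : 1 ≤ j) (hjk : j ≤ k) {c : Site d × Fin d}
    (hc : c ∈ cubeLamBP L a M ρ k k j) :
    ∀ x, InBox (loK L j c.1) (bondHiK L j c.1 c.2) x → x ∈ (fun j => cubeFam true L a M ρ k (j - 1)) j := by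
  intro x hx
  show x ∈ cubeFam true L a M ρ k (j - 1)
  rcases Nat.eq_or_lt_of_le hj1 with h1 | h1
  · rw [← h1, Nat.sub_self, cubeFam_true_zero]; exact Set.mem_univ x
  · rw [cubeFam_of_pos true L a M ρ (by omega) (by omega)]
    exact cubeLamBP_box_subset_pred hL a M hρ hj1 le_rfl hc x hx

/-- ★ **THE CLASS AVERAGE `LʲηQ_j(U₀)B(c)` OF A FIELD BOUNDED ON THE BOND'S BOX, AT A BACKGROUND IN `𝔄_k(α)`**: for a class bond `c` of print's class at level `1 ≤ j ≤ k`
over the top-cube tower, `U₀` unitary in `𝔄_k((T, □_j), α)` with `αL² ≤ α_Q`, and `‖B‖ ≤ β` on the bonds of `Bʲ(c₋) ∪ Bʲ(c₊)`: `‖LʲηQ_j(U₀)B(c)‖ ≤ 2d(1 + θ(αL²))Lʲ·β` —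
[B7] Prop. 5's bound (`B9Eq316AveragingTransposeZd.norm_linCovIter_le_of_reg17`) at the SHIFTED family (the box lies in `□_{j−1}`, where (1.7) reads `αL²·L^{−2j}`).
[cite: Balaban1985Averaging, (127) p.37, Prop. 5 p.42; Balaban1985RegularSpaces, (1.7) p.77, (1.31) p.82; Balaban1984PropagatorsII, (2.3) p.224] -/
theorem norm_linCovIter_cubeLamBP_le (hL2 : 2 ≤ L) (hρ : L ≤ ρ) (hα : 0 < α) (hαQ : α * (L : ℝ) ^ 2 ≤ alphaQ d L)
    (hU₀ : ∀ x κ, U₀ x κ ∈ unitaryUnits 𝔹) (hAk : InAk L k η α (cubeFam true L a M ρ k) U₀) {j : ℕ} (hj1 : 1 ≤ j) (hjk : j ≤ k)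
    {c : Site d × Fin d} (hc : c ∈ cubeLamBP L a M ρ k k j) (B : Site d → Fin d → 𝔹) {β : ℝ} (hβ : 0 ≤ β)
    (hB : ∀ (y : Site d) (μ : Fin d), BondIn (loK L j c.1) (bondHiK L j c.1 c.2) y μ → ‖B y μ‖ ≤ β) :
    ‖linCovIter L U₀ B j c.1 c.2‖ ≤ 2 * d * ((1 + thetaGen d L (α * (L : ℝ) ^ 2)) * (L : ℝ) ^ j) * β := by
  have hL1 : 1 ≤ L := le_trans (by norm_num) hL2
  have hreg : Reg17 L k (fun j => cubeFam true L a M ρ k (j - 1)) (α * (L : ℝ) ^ 2) U₀ :=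
    reg17_shift hL1 hα.le (reg17_of_inAk hAk le_rfl)
  exact norm_linCovIter_le_of_reg17 hL2 (by positivity) hαQ hU₀ hreg hjk c.1 c.2 (box_subset_shift_of_cubeLamBP hL1 hρ hj1 hjk hc) B hβ hB

/-- **The class average is additive in the field at such a bond** (`B9Eq316AveragingTransposeZdLinear.linCovIter_add_of_reg17` at the shifted family), in the form
`Q_j(B − B′) = Q_jB − Q_jB′`. [cite: Balaban1985Averaging, (127) p.37, (122) p.36] -/
theorem linCovIter_sub_cubeLamBP (hL2 : 2 ≤ L) (hρ : L ≤ ρ) (hα : 0 < α) (hαQ : α * (L : ℝ) ^ 2 ≤ alphaQ d L)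
    (hU₀ : ∀ x κ, U₀ x κ ∈ unitaryUnits 𝔹) (hAk : InAk L k η α (cubeFam true L a M ρ k) U₀) {j : ℕ} (hj1 : 1 ≤ j) (hjk : j ≤ k)
    {c : Site d × Fin d} (hc : c ∈ cubeLamBP L a M ρ k k j) (B B' : Site d → Fin d → 𝔹) :
    linCovIter L U₀ (B - B') j c.1 c.2 = linCovIter L U₀ B j c.1 c.2 - linCovIter L U₀ B' j c.1 c.2 := by
  have hL1 : 1 ≤ L := le_trans (by norm_num) hL2
  have hreg : Reg17 L k (fun j => cubeFam true L a M ρ k (j - 1)) (α * (L : ℝ) ^ 2) U₀ :=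
    reg17_shift hL1 hα.le (reg17_of_inAk hAk le_rfl)
  have h := linCovIter_add_of_reg17 hL2 (by positivity) hαQ hU₀ hreg hjk c.1 c.2 (box_subset_shift_of_cubeLamBP hL1 hρ hj1 hjk hc) (B - B') B'
  rw [sub_add_cancel] at h
  rw [h, add_sub_cancel_right]

end Averages

end Literature.MathematicalPhysics.QuantumFieldTheory.Balaban1983to89.B8Ineq159TopCubeTowerSourceReads

end
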